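import Summits.QuantumFields.YangMills.Theorems.FluctuationComparisonRegPrIntLOrganTangentFibreMeanVersionKnit
import Literature.MathematicalPhysics.QuantumFieldTheory.Balaban1983to89.T3MinimiserStabilityReduction
import Literature.MathematicalPhysics.QuantumFieldTheory.Balaban1983to89.T4AveragingDisintegration
import Literature.MathematicalPhysics.QuantumFieldTheory.Balaban1983to89.BalabanAdmissibleClassParams
import HarnessLib

/-!
# VER∘'s GEOMETRIC INPUT IN ONE CURRENCY: ⟨(A) regular small-field disintegration from a height⟩ ⟹ VER∘ v2.3, COAREA∘ ⟹ (A), COAREA∘ ⟹ VER∘ — the χ-inside (D25-8-immune) half of E2E-A ∕ E2E-C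

Cell `ym3-torus` (YM ladder rung R3 = continuum `SU(2)` Yang–Mills on the three-torus — a RUNG, NOT d = 4, NOT infinite volume, NOT a mass gap, NOT Clay).  Width seat
`ym-ust-20520-w5` (gen 21), rows (R2′)∕(E2E-C) named∕granted by LEAD-20520 w3 g22 (2026-08-30 17:15:19Z, 17:35:05Z), SPLIT per ★★OWNER RULING №54 (3): this file keeps
ONLY the theorems whose conclusions are χ-inside rows (VER∘, the (A)-package) — immune to census D25-8 «lf-transplant»; the two three-line compositions to O1
(`oneStepContractionRun_of_regular_tangentCut`, `…_of_coarea_tangentCut`, via w4 g20's ✓T-LIFT-1) wait for the O1 text of record (v16 under review, flag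
`D25-8-conditional`; v17 if confirmed) and re-lift mechanically.  `--supports stmt-QuantumFields-20520 --as helper`, count-neutral, definition-free, default heartbeats; no
registry, binder or `Lines/` edit (the registered skeleton `Lines/semiclassical_s2beta.lean` v11.4 and its five stubs are untouched, 0∕5, ★★OWNER RULING №36).

WHAT THIS IS.  Ideator `ym-r3-idea-1` g25's LINE g25-1 «organ_tangent» v2.3 (`Cruxes/FluctuationComparisonRegPrIntL/Lines/organ_tangent.lean` b0d6cb8262483029) row VER∘
`FibreMeanVersionCan` (a window-continuous version of the small-field-LOCALISED fibre mean, in the regime `0 < γ ≤ 1`, `0 < b₀`, `0 < p₀`, from a height `jV`) has ONE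
geometric input, typed in two currencies: LEAD w3 g22's (A)-package (✓`OrganTangentFibreMeanVersionKnit` v3 binders: ONE Markov disintegration `σ₀` of `dU_{j+1}` along
`descend`, a finite fibre family `lam`, (A1) window-continuity of `V ↦ ∫ f dlam_V` for continuous `f` supported in the `¾`-window, (A2) positive `lam_V`-mass of the `¾`-window,
(A3) a fixed weight `c` with `∫ f dσ₀_V = c(V)·∫ f dlam_V` for each such `f`, `descend_* dU_{j+1}`-a.e. on the window) and ideator g25's LINE g25-3 «version_coarea» v1
(`Lines/version_coarea.lean` 5a1864e0c826a8b3) row COAREA∘ `RegularFibrePackageCan` (INT ∕ CONT ∕ MASS ∕ DISINT-with-`φ` for EVERY kernel, `dU_j`-a.e.).  ★★OWNER №134 (2)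
asked for ONE supplier text; LEAD's cert (ii) settled the direction COAREA∘ ⟹ (A) (the converse is not claimed: DISINT for every kernel and `dU_j`-a.e. needs the measure class
that only O1's frame supplies).  THIS FILE puts the three implications IN THE TREE, definition-free, the Lines' cutoff `sfCut θ U` written as its TERM
`∏_p max 0 (min 1 (3 − 4·dist1(U(∂p))∕θ))` throughout:

* §1 **`fibreMeanVersion_of_regular`** — `(∀ F γ b₀ p₀, 0 < γ → γ ≤ 1 → 0 < b₀ → 0 < p₀ → ∃ jA, ∀ j ≥ jA, ⟨(A)-package at j, INLINE (body of LEAD's cert bundle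
  `RegularSmallFieldDisintegration`, v3)⟩) → ⟨VER∘ v2.3 VERBATIM⟩`, `jV := jA` (LEAD's doorfit (i) on tree names: ✓`fibreMeanVersion_of_regularSmallFieldDisintegration` at `χ :=` the
  cutoff term, ✓TOOLS §4 `continuous_sfCutTerm`∕`sfCutTerm_nonneg`∕`plaqSmall_of_sfCutTerm_ne_zero`∕`sfCutTerm_pos_of_plaqSmall`, lit ✓`θBal_pos`, the frame's window clauses at
  heights `j`, `j+1` and its consistency∕density identity).
* §2 **`regular_of_coarea`** — `⟨COAREA∘ v1⟩ → ⟨(A) from the same height⟩` (LEAD's doorfit (ii) on tree names: `σ₀ :=` the conditional kernel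
  `T4AveragingDisintegration.condLaw dU_{j+1} (descend F ℰp j)` re-derived in place — the term of ✓`FibreLaplace.stub_descentDisintegration`, route-free, as in ✓T-LIFT-1;
  `lam V` finite from INT at `g ≡ 1` (`integrable_const_iff`); (A1) = CONT and (A3) = DISINT at `σ₀` through the support dictionary `sfCut θ′ U = 0 ↔ ¬PlaqSmall (¾θ′) U`
  (TOOLS §4); DISINT's `dU_j`-a.e. ⟹ `descend_* dU_{j+1}`-a.e. by TOOLS §5 ✓`absolutelyContinuous_map_descend`; `c := φ⁻¹`; (A2) = MASS verbatim).
* §3 **`fibreMeanVersion_of_coarea`** — `⟨COAREA∘⟩ → ⟨VER∘ v2.3⟩ := fibreMeanVersion_of_regular (regular_of_coarea hC)`: g25-3's ★ `fibreMeanVersion_of_coarea hC hP` with the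
  routine row PINCH∘ `hP` absorbed (its content is TOOLS §3–§4 inside the KNIT; the row itself is discharged separately in ✓-to-be `…VersionCoareaPinch`).

HONEST FRAMING.  Knits over hypothesis letters; the (A)-package and COAREA∘ are HYPOTHESES (displayed as antecedents, never smuggled); nothing of Bałaban's is asserted or proved;
COAREA∘ (idea-crit-5 GATE ASK №18 pending), (A1)–(A3), VER∘ (as a row), LIN∘, JEN∘, O1, the five registered ∘-stubs, crux stmt-QuantumFields-20520 `FluctuationComparisonRegPrIntL`
and `YM3TorusSU2` are NOT proved; no summit ∕ sub-problem statement is proved; rung R3 = SU(2) YM₃ on T³ — NOT d = 4, NOT infinite volume, NOT a mass gap, NOT Clay; the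
Yang–Mills mass gap is NOT proved by any of this.  All credit for the mathematics: ideator g25 (VER∘, COAREA∘), LEAD w3 g22 (the (A)-package, TOOLS, KNIT and both doorfit proofs);
this seat only re-keys them on tree names.
[cite: Balaban1985Averaging, (10)-(13) p.19; Balaban1987RG1, (0.13) p.254 and (0.18) p.255; Balaban1985UV3, (42)-(44) pp.266-267]
-/

set_option autoImplicit false

noncomputable section

namespace Summit.QuantumFields.YangMills.Theorems.FluctuationComparisonRegPrIntLOrganTangentRegularVersion

open MeasureTheory Filter Topology
open scoped ENNReal
open Literature.MathematicalPhysics.QuantumFieldTheory.Balaban1983to89 T3ContinuumYM3Torus T3NestedUnitLaws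
  T3UnitLawDensityEML T4Continuum BalabanUVClass T3UnitScaleTilt
open Summit.QuantumFields.YangMills.Theorems.OrganTangentFibreMeanTools
  (continuous_sfCutTerm sfCutTerm_nonneg plaqSmall_of_sfCutTerm_ne_zero sfCutTerm_pos_of_plaqSmall absolutelyContinuous_map_descend)
open Summit.QuantumFields.YangMills.Theorems.OrganTangentFibreMeanVersionKnit (fibreMeanVersion_of_regularSmallFieldDisintegration)

/-! ## §1 (A) from a height ⟹ VER∘ v2.3 (cutoff as its term) -/

/-- **(A) FROM A HEIGHT ⟹ VER∘ v2.3.**  In the coupling window `0 < γ ≤ 1`, `0 < b₀`, `0 < p₀`: if from some height `jA(F, γ, b₀, p₀)` on the averaging map `descend` at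
height `j` admits a REGULAR SMALL-FIELD DISINTEGRATION (one Markov disintegration `σ₀` of product Haar, a finite fibre family `lam` with (A1) window-continuity of
`V ↦ ∫ f dlam_V` for continuous `f` supported in the `¾`-window, (A2) positive `lam_V`-mass of the `¾`-window, (A3) `∫ f dσ₀_V = c(V)·∫ f dlam_V` for continuous `f` vanishing off the `¾`-window, a.e.), then
row VER∘ `FibreMeanVersionCan` of «organ_tangent» v2.3 holds VERBATIM (its cutoff `sfCut θ U` written as the term `∏_p max 0 (min 1 (3 − 4·dist1(U(∂p))∕θ))`), with
`jV := jA` — by LEAD w3 g22's ✓`fibreMeanVersion_of_regularSmallFieldDisintegration` at `χ :=` the cutoff term, `r := ρ (j+1)`, `r′ := ρ′ (j+1)`, `rj := ρ j`, the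
frame's window clauses at heights `j`, `j+1` and its consistency∕density identity. [cite: Balaban1985Averaging, (10)-(13) p.19; Balaban1987RG1, (0.13) p.254] -/
theorem fibreMeanVersion_of_regular
    (hA : ∀ (F : T3Family) (γ b₀ p₀ : ℝ), 0 < γ → γ ≤ 1 → 0 < b₀ → 0 < p₀ → ∃ jA : ℕ, ∀ j : ℕ, jA ≤ j →
        ∃ (σ₀ : ProbabilityTheory.Kernel (GaugeField (F.P j) 0 ↥(Matrix.specialUnitaryGroup (Fin 2) ℂ))
            (GaugeField (F.P (j + 1)) 0 ↥(Matrix.specialUnitaryGroup (Fin 2) ℂ)))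
          (lam : GaugeField (F.P j) 0 ↥(Matrix.specialUnitaryGroup (Fin 2) ℂ) →
            Measure (GaugeField (F.P (j + 1)) 0 ↥(Matrix.specialUnitaryGroup (Fin 2) ℂ))),
          ProbabilityTheory.IsMarkovKernel σ₀ ∧
          (Measure.map (descend F ℰp j) (fieldMeasure (F.P (j + 1)) 0 ↥(Matrix.specialUnitaryGroup (Fin 2) ℂ))).bind ⇑σ₀ =
            fieldMeasure (F.P (j + 1)) 0 ↥(Matrix.specialUnitaryGroup (Fin 2) ℂ) ∧
          (∀ᵐ V ∂(Measure.map (descend F ℰp j) (fieldMeasure (F.P (j + 1)) 0 ↥(Matrix.specialUnitaryGroup (Fin 2) ℂ))),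
            ∀ᵐ U ∂(σ₀ V), descend F ℰp j U = V) ∧
          (∀ V, IsFiniteMeasure (lam V)) ∧
          (∀ f : GaugeField (F.P (j + 1)) 0 ↥(Matrix.specialUnitaryGroup (Fin 2) ℂ) → ℝ, Continuous f →
            (∀ U, f U ≠ 0 → PlaqSmall (3 / 4 * θBal F.L γ b₀ p₀ (j + 1)) U) →
            ContinuousOn (fun V => ∫ U, f U ∂(lam V)) {V | PlaqSmall (θBal F.L γ b₀ p₀ j) V}) ∧
          (∀ V, PlaqSmall (θBal F.L γ b₀ p₀ j) V → 0 < lam V {U | PlaqSmall (3 / 4 * θBal F.L γ b₀ p₀ (j + 1)) U}) ∧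
          (∃ c : GaugeField (F.P j) 0 ↥(Matrix.specialUnitaryGroup (Fin 2) ℂ) → ℝ,
            ∀ f : GaugeField (F.P (j + 1)) 0 ↥(Matrix.specialUnitaryGroup (Fin 2) ℂ) → ℝ, Continuous f →
              (∀ U, ¬ PlaqSmall (3 / 4 * θBal F.L γ b₀ p₀ (j + 1)) U → f U = 0) →
              ∀ᵐ V ∂(Measure.map (descend F ℰp j) (fieldMeasure (F.P (j + 1)) 0 ↥(Matrix.specialUnitaryGroup (Fin 2) ℂ))),
                PlaqSmall (θBal F.L γ b₀ p₀ j) V → 0 < c V ∧ ∫ U, f U ∂(σ₀ V) = c V * ∫ U, f U ∂(lam V)))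
    :
    ∀ (F : T3Family) (γ b₀ p₀ : ℝ), 0 < γ → γ ≤ 1 → 0 < b₀ → 0 < p₀ → ∃ jV : ℕ, ∀ (j₀ : ℕ) (prm : ℕ → ClassParams) (η : ℕ → ℝ), ∀ (T : ℕ), ∀ (μ μ' : ((j : ℕ) → MeasureTheory.Measure (GaugeField (F.P j) 0 ↥(Matrix.specialUnitaryGroup (Fin 2) ℂ)))) (ρ ρ' : ((j : ℕ) → GaugeField (F.P j) 0 ↥(Matrix.specialUnitaryGroup (Fin 2) ℂ) → ℝ)), (∀ j : ℕ, j ≤ T → IsProbabilityMeasure (μ j) ∧ IsProbabilityMeasure (μ' j)) → (∀ j : ℕ, j < T → μ j = Measure.map (descend F ℰp j) (μ (j + 1)) ∧ μ' j = Measure.map (descend F ℰp j) (μ' (j + 1))) → (∀ j : ℕ, j₀ ≤ j → j ≤ T → ((∀ U, PlaqSmall (θBal F.L γ b₀ p₀ j) U → 0 < ρ j U ∧ 0 < ρ' j U) ∧ μ j = (fieldMeasure _ _ _).withDensity (fun U => ENNReal.ofReal (ρ j U)) ∧ μ' j = (fieldMeasure _ _ _).withDensity (fun U => ENNReal.ofReal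 (ρ' j U)) ∧ MemAtHeight F ℰp j (prm j) (ρ j) ∧ MemAtHeight F ℰp j (prm j) (ρ' j) ∧ μ j {U | ¬ PlaqSmall (θBal F.L γ b₀ p₀ j) U} ≤ ENNReal.ofReal (η j) ∧ μ' j {U | ¬ PlaqSmall (θBal F.L γ b₀ p₀ j) U} ≤ ENNReal.ofReal (η j) ∧ (ContinuousOn (ρ j) {U | PlaqSmall (θBal F.L γ b₀ p₀ j) U} ∧ ContinuousOn (ρ' j) {U | PlaqSmall (θBal F.L γ b₀ p₀ j) U}))) → ∀ (j : ℕ), jV ≤ j → j₀ ≤ j → j + 1 ≤ T → ∀ (σ : ProbabilityTheory.Kernel (GaugeField (F.P j) 0 ↥(Matrix.specialUnitaryGroup (Fin 2) ℂ)) (GaugeField (F.P (j + 1)) 0 ↥(Matrix.specialUnitaryGroup (Fin 2) ℂ))), ProbabilityTheory.IsMarkovKernel σ → (Measure.map (descend F ℰp j) (fieldMeasure (F.P (j + 1)) 0 ↥(Matrix.specialUnitaryGroup (Fin 2) ℂ))).bind ⇑σ = fieldMeasure (F.P (j + 1)) 0 ↥(Matrix.specialUnitaryGroup (Fin 2) ℂ)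 → (∀ᵐ V ∂(Measure.map (descend F ℰp j) (fieldMeasure (F.P (j + 1)) 0 ↥(Matrix.specialUnitaryGroup (Fin 2) ℂ))), ∀ᵐ U ∂(σ V), descend F ℰp j U = V) → ∃ (m : GaugeField (F.P j) 0 ↥(Matrix.specialUnitaryGroup (Fin 2) ℂ) → ℝ), ContinuousOn m {V | PlaqSmall (θBal F.L γ b₀ p₀ j) V} ∧ (∀ᵐ V ∂(fieldMeasure (F.P j) 0 ↥(Matrix.specialUnitaryGroup (Fin 2) ℂ)), PlaqSmall (θBal F.L γ b₀ p₀ j) V → MeasureTheory.Integrable (fun U => (∏ p : Plaq (F.P (j + 1)) 0, max 0 (min 1 (3 - 4 * dist1 (GaugeField.plaqHol U p) / θBal F.L γ b₀ p₀ (j + 1)))) * (Real.log (ρ (j + 1) U) - Real.log (ρ' (j + 1) U)) * ρ' (j + 1) U) (σ V) ∧ m V = (∫ U, (∏ p : Plaq (F.P (j + 1)) 0, max 0 (min 1 (3 - 4 * dist1 (GaugeField.plaqHol U p) / θBal F.L γ b₀ p₀ (j + 1)))) * (Real.log (ρ (j + 1) U) - Real.log (ρ' (j + 1) U)) * ρ'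 (j + 1) U ∂(σ V)) / (∫ U, (∏ p : Plaq (F.P (j + 1)) 0, max 0 (min 1 (3 - 4 * dist1 (GaugeField.plaqHol U p) / θBal F.L γ b₀ p₀ (j + 1)))) * ρ' (j + 1) U ∂(σ V))) := by
  intro F γ b₀ p₀ hγ hγ1 hb₀ hp₀
  obtain ⟨jA, hjA⟩ := hA F γ b₀ p₀ hγ hγ1 hb₀ hp₀
  refine ⟨jA, ?_⟩
  intro j₀ prm η T μ μ' ρ ρ' hprob hcons hwin j hjAj hj hjT σ hσM hbind hfib
  have hθ : 0 < θBal F.L γ b₀ p₀ (j + 1) := T3MinimiserStabilityReduction.θBal_pos F.hL.2.le hγ hγ1 hb₀ p₀ (j + 1)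
  obtain ⟨σ₀, lam, hσ₀M, hbind₀, hfib₀, hlam, hA1, hA2, hA3⟩ := hjA j hjAj
  have hw1 := hwin (j + 1) (by omega) hjT
  have hw0 := hwin j hj (by omega)
  have hc := (hcons j (by omega)).1
  have hdens : ((fieldMeasure (F.P (j + 1)) 0 ↥(Matrix.specialUnitaryGroup (Fin 2) ℂ)).withDensity
        (fun U => ENNReal.ofReal (ρ (j + 1) U))).map (descend F ℰp j) =
      (fieldMeasure (F.P j) 0 ↥(Matrix.specialUnitaryGroup (Fin 2) ℂ)).withDensity (fun V => ENNReal.ofReal (ρ j V)) := by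
    rw [← hw1.2.1, ← hc, hw0.2.1]
  exact fibreMeanVersion_of_regularSmallFieldDisintegration F γ b₀ p₀ j hθ (ρ (j + 1)) (ρ' (j + 1)) (ρ j)
    hw1.1 hw1.2.2.2.2.2.2.2.1 hw1.2.2.2.2.2.2.2.2 hw0.2.2.2.1.measurable (fun V hV => (hw0.1 V hV).1) hdens
    σ hσM hbind hfib
    (fun U => ∏ p : Plaq (F.P (j + 1)) 0, max 0 (min 1 (3 - 4 * dist1 (GaugeField.plaqHol U p) / θBal F.L γ b₀ p₀ (j + 1))))
    (continuous_sfCutTerm _) (sfCutTerm_nonneg _) (plaqSmall_of_sfCutTerm_ne_zero hθ) (sfCutTerm_pos_of_plaqSmall hθ)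
    σ₀ hσ₀M hbind₀ hfib₀ lam hlam hA1 hA2 hA3

/-! ## §2 COAREA∘ ⟹ the (A)-package, height by height -/

/-- **g25-3's COAREA∘ IMPLIES the (A)-package from the same height** (LEAD w3 g22's doorfit (ii), in the tree): for EVERY kernel and `dU_j`-a.e. (COAREA∘'s DISINT) is
more than ONE kernel and `descend_* dU_{j+1}`-a.e. ((A3)); `σ₀ :=` the conditional kernel of `dU_{j+1}` along `descend` (Markov, `bind` and fibre clauses — the term of
✓`FibreLaplace.stub_descentDisintegration`, re-derived route-free); `c := φ⁻¹`; finiteness of `lam V` from INT at the constant `1`; the support conventions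
`sfCut θ′ U = 0 ↔ ¬ PlaqSmall (¾θ′) U` from TOOLS §4. [cite: Balaban1985Averaging, (10)-(13) p.19; Balaban1987RG1, (0.13) p.254] -/
theorem regular_of_coarea
    (hC : ∀ (F : T3Family) (γ b₀ p₀ : ℝ), 0 < γ → γ ≤ 1 → 0 < b₀ → 0 < p₀ → ∃ jV : ℕ, ∀ (j : ℕ), jV ≤ j → ∃ (lam : GaugeField (F.P j) 0 ↥(Matrix.specialUnitaryGroup (Fin 2) ℂ) → MeasureTheory.Measure (GaugeField (F.P (j + 1)) 0 ↥(Matrix.specialUnitaryGroup (Fin 2) ℂ))), (∀ (V : GaugeField (F.P j) 0 ↥(Matrix.specialUnitaryGroup (Fin 2) ℂ)) (g : GaugeField (F.P (j + 1)) 0 ↥(Matrix.specialUnitaryGroup (Fin 2) ℂ) → ℝ), Continuous g → MeasureTheory.Integrable g (lam V)) ∧ (∀ (g : GaugeField (F.P (j + 1)) 0 ↥(Matrix.specialUnitaryGroup (Fin 2) ℂ) → ℝ), Continuous g → (∀ U, (∏ p : Plaq (F.P (j + 1)) 0, max 0 (min 1 (3 - 4 * dist1 (GaugeField.plaqHol U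 p) / θBal F.L γ b₀ p₀ (j + 1)))) = 0 → g U = 0) → ContinuousOn (fun V => ∫ U, g U ∂(lam V)) {V | PlaqSmall (θBal F.L γ b₀ p₀ j) V}) ∧ (∀ (V : GaugeField (F.P j) 0 ↥(Matrix.specialUnitaryGroup (Fin 2) ℂ)), PlaqSmall (θBal F.L γ b₀ p₀ j) V → 0 < lam V {U | PlaqSmall (3 / 4 * θBal F.L γ b₀ p₀ (j + 1)) U}) ∧ (∀ (σ : ProbabilityTheory.Kernel (GaugeField (F.P j) 0 ↥(Matrix.specialUnitaryGroup (Fin 2) ℂ)) (GaugeField (F.P (j + 1)) 0 ↥(Matrix.specialUnitaryGroup (Fin 2) ℂ))), ProbabilityTheory.IsMarkovKernel σ → (Measure.map (descend F ℰp j) (fieldMeasure (F.P (j + 1)) 0 ↥(Matrix.specialUnitaryGroup (Fin 2) ℂ))).bind ⇑σ = fieldMeasure (F.P (j + 1)) 0 ↥(Matrix.specialUnitaryGroup (Fin 2) ℂ) → (∀ᵐ V ∂(Measure.map (descend F ℰp j) (fieldMeasure (F.P (j + 1)) 0 ↥(Matrix.specialUnitaryGroup (Fin 2) ℂ))), ∀ᵐ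 U ∂(σ V), descend F ℰp j U = V) → ∃ (φ : GaugeField (F.P j) 0 ↥(Matrix.specialUnitaryGroup (Fin 2) ℂ) → ℝ), ∀ᵐ V ∂(fieldMeasure (F.P j) 0 ↥(Matrix.specialUnitaryGroup (Fin 2) ℂ)), PlaqSmall (θBal F.L γ b₀ p₀ j) V → 0 < φ V ∧ ∀ (g : GaugeField (F.P (j + 1)) 0 ↥(Matrix.specialUnitaryGroup (Fin 2) ℂ) → ℝ), Continuous g → (∀ U, (∏ p : Plaq (F.P (j + 1)) 0, max 0 (min 1 (3 - 4 * dist1 (GaugeField.plaqHol U p) / θBal F.L γ b₀ p₀ (j + 1)))) = 0 → g U = 0) → MeasureTheory.Integrable g (σ V) ∧ ∫ U, g U ∂(σ V) = (φ V)⁻¹ * ∫ U, g U ∂(lam V))) :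
    ∀ (F : T3Family) (γ b₀ p₀ : ℝ), 0 < γ → γ ≤ 1 → 0 < b₀ → 0 < p₀ → ∃ jA : ℕ, ∀ j : ℕ, jA ≤ j →
        ∃ (σ₀ : ProbabilityTheory.Kernel (GaugeField (F.P j) 0 ↥(Matrix.specialUnitaryGroup (Fin 2) ℂ))
            (GaugeField (F.P (j + 1)) 0 ↥(Matrix.specialUnitaryGroup (Fin 2) ℂ)))
          (lam : GaugeField (F.P j) 0 ↥(Matrix.specialUnitaryGroup (Fin 2) ℂ) →
            Measure (GaugeField (F.P (j + 1)) 0 ↥(Matrix.specialUnitaryGroup (Fin 2) ℂ))),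
          ProbabilityTheory.IsMarkovKernel σ₀ ∧
          (Measure.map (descend F ℰp j) (fieldMeasure (F.P (j + 1)) 0 ↥(Matrix.specialUnitaryGroup (Fin 2) ℂ))).bind ⇑σ₀ =
            fieldMeasure (F.P (j + 1)) 0 ↥(Matrix.specialUnitaryGroup (Fin 2) ℂ) ∧
          (∀ᵐ V ∂(Measure.map (descend F ℰp j) (fieldMeasure (F.P (j + 1)) 0 ↥(Matrix.specialUnitaryGroup (Fin 2) ℂ))),
            ∀ᵐ U ∂(σ₀ V), descend F ℰp j U = V) ∧
          (∀ V, IsFiniteMeasure (lam V)) ∧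
          (∀ f : GaugeField (F.P (j + 1)) 0 ↥(Matrix.specialUnitaryGroup (Fin 2) ℂ) → ℝ, Continuous f →
            (∀ U, f U ≠ 0 → PlaqSmall (3 / 4 * θBal F.L γ b₀ p₀ (j + 1)) U) →
            ContinuousOn (fun V => ∫ U, f U ∂(lam V)) {V | PlaqSmall (θBal F.L γ b₀ p₀ j) V}) ∧
          (∀ V, PlaqSmall (θBal F.L γ b₀ p₀ j) V → 0 < lam V {U | PlaqSmall (3 / 4 * θBal F.L γ b₀ p₀ (j + 1)) U}) ∧
          (∃ c : GaugeField (F.P j) 0 ↥(Matrix.specialUnitaryGroup (Fin 2) ℂ) → ℝ,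
            ∀ f : GaugeField (F.P (j + 1)) 0 ↥(Matrix.specialUnitaryGroup (Fin 2) ℂ) → ℝ, Continuous f →
              (∀ U, ¬ PlaqSmall (3 / 4 * θBal F.L γ b₀ p₀ (j + 1)) U → f U = 0) →
              ∀ᵐ V ∂(Measure.map (descend F ℰp j) (fieldMeasure (F.P (j + 1)) 0 ↥(Matrix.specialUnitaryGroup (Fin 2) ℂ))),
                PlaqSmall (θBal F.L γ b₀ p₀ j) V → 0 < c V ∧ ∫ U, f U ∂(σ₀ V) = c V * ∫ U, f U ∂(lam V)) := by
  intro F γ b₀ p₀ hγ hγ1 hb₀ hp₀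
  obtain ⟨jV, hjV⟩ := hC F γ b₀ p₀ hγ hγ1 hb₀ hp₀
  refine ⟨jV, fun j hj => ?_⟩
  have hθ : 0 < θBal F.L γ b₀ p₀ (j + 1) := T3MinimiserStabilityReduction.θBal_pos F.hL.2.le hγ hγ1 hb₀ p₀ (j + 1)
  obtain ⟨lam, hint, hcont, hmass, hdis⟩ := hjV j hj
  -- the disintegration kernel of record, route-free (the term of ✓`FibreLaplace.stub_descentDisintegration`, as in ✓T-LIFT-1)
  obtain ⟨σ₀, hσ₀M, hbind₀, hfib₀⟩ : ∃ σ : ProbabilityTheory.Kernel (GaugeField (F.P j) 0 ↥(Matrix.specialUnitaryGroup (Fin 2) ℂ)) (GaugeField (F.P (j + 1)) 0 ↥(Matrix.specialUnitaryGroup (Fin 2) ℂ)),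
      ProbabilityTheory.IsMarkovKernel σ ∧
        (Measure.map (descend F ℰp j) (fieldMeasure (F.P (j + 1)) 0 ↥(Matrix.specialUnitaryGroup (Fin 2) ℂ))).bind ⇑σ = fieldMeasure (F.P (j + 1)) 0 ↥(Matrix.specialUnitaryGroup (Fin 2) ℂ) ∧
          ∀ᵐ V ∂(Measure.map (descend F ℰp j) (fieldMeasure (F.P (j + 1)) 0 ↥(Matrix.specialUnitaryGroup (Fin 2) ℂ))), ∀ᵐ U ∂(σ V), descend F ℰp j U = V := by
    have havg : Measurable (descend F ℰp j : GaugeField (F.P (j + 1)) 0 ↥(Matrix.specialUnitaryGroup (Fin 2) ℂ) → GaugeField (F.P j) 0 ↥(Matrix.specialUnitaryGroup (Fin 2) ℂ)) :=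
      measurable_descend F ℰp measurableE_ℰp j
    haveI : Nonempty (GaugeField (F.P (j + 1)) 0 ↥(Matrix.specialUnitaryGroup (Fin 2) ℂ)) := ⟨fun _ => 1⟩
    refine ⟨T4AveragingDisintegration.condLaw (fieldMeasure (F.P (j + 1)) 0 ↥(Matrix.specialUnitaryGroup (Fin 2) ℂ)) (descend F ℰp j), inferInstance, ?_, ?_⟩
    · have h := T4AveragingDisintegration.fst_compProd_condLaw (fieldMeasure (F.P (j + 1)) 0 ↥(Matrix.specialUnitaryGroup (Fin 2) ℂ)) (descend F ℰp j)
      rw [T4AveragingDisintegration.jointLaw_fst _ havg] at h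
      have h2 := congrArg Measure.snd h
      rw [Measure.snd_compProd, T4AveragingDisintegration.jointLaw_snd _ havg] at h2
      exact h2
    · filter_upwards [T4AveragingDisintegration.condLaw_fibre_ae (fieldMeasure (F.P (j + 1)) 0 ↥(Matrix.specialUnitaryGroup (Fin 2) ℂ)) havg] with V hV
      rw [ae_iff]
      exact (prob_compl_eq_zero_iff (measurableSet_eq_fun havg measurable_const)).2 hV
  obtain ⟨φ, hφ⟩ := hdis σ₀ hσ₀M hbind₀ hfib₀
  haveI : ∀ V, IsFiniteMeasure (lam V) := fun V => by
    have h1 : Integrable (fun _ : GaugeField (F.P (j + 1)) 0 ↥(Matrix.specialUnitaryGroup (Fin 2) ℂ) => (1 : ℝ)) (lam V) := hint V _ continuous_const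
    exact (integrable_const_iff.mp h1).resolve_left one_ne_zero
  -- the support conventions agree: `sfCut θ' U = 0 ↔ ¬ PlaqSmall (¾θ') U`
  have hnot_of_zero : ∀ U : GaugeField (F.P (j + 1)) 0 ↥(Matrix.specialUnitaryGroup (Fin 2) ℂ),
      (∏ p : Plaq (F.P (j + 1)) 0, max 0 (min 1 (3 - 4 * dist1 (GaugeField.plaqHol U p) / θBal F.L γ b₀ p₀ (j + 1)))) = 0 →
        ¬ PlaqSmall (3 / 4 * θBal F.L γ b₀ p₀ (j + 1)) U := by
    intro U hU hP
    exact (sfCutTerm_pos_of_plaqSmall hθ U hP).ne' hU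
  refine ⟨σ₀, lam, hσ₀M, hbind₀, hfib₀, inferInstance, ?_, hmass, ?_⟩
  · intro f hf hsupp
    exact hcont f hf fun U hU => by
      by_contra h
      exact (hnot_of_zero U hU) (hsupp U h)
  · have hφ' : ∀ᵐ V ∂(Measure.map (descend F ℰp j) (fieldMeasure (F.P (j + 1)) 0 ↥(Matrix.specialUnitaryGroup (Fin 2) ℂ))),
        PlaqSmall (θBal F.L γ b₀ p₀ j) V → 0 < φ V ∧ ∀ (g : GaugeField (F.P (j + 1)) 0 ↥(Matrix.specialUnitaryGroup (Fin 2) ℂ) → ℝ),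
          Continuous g → (∀ U, (∏ p : Plaq (F.P (j + 1)) 0, max 0 (min 1 (3 - 4 * dist1 (GaugeField.plaqHol U p) / θBal F.L γ b₀ p₀ (j + 1)))) = 0 → g U = 0) →
            MeasureTheory.Integrable g (σ₀ V) ∧ ∫ U, g U ∂(σ₀ V) = (φ V)⁻¹ * ∫ U, g U ∂(lam V) :=
      (absolutelyContinuous_map_descend F j).ae_le hφ
    refine ⟨fun V => (φ V)⁻¹, fun f hf hf0 => ?_⟩
    filter_upwards [hφ'] with V hV hVW
    obtain ⟨hφpos, hφg⟩ := hV hVW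
    exact ⟨inv_pos.mpr hφpos, (hφg f hf fun U hU => hf0 U (hnot_of_zero U hU)).2⟩

/-! ## §3 COAREA∘ ⟹ VER∘ v2.3 (g25-3's ★ with PINCH∘ absorbed) -/

/-- **COAREA∘ ⟹ VER∘ v2.3** (cutoff as its term; `jV := jA`): LINE g25-3's junction `fibreMeanVersion_of_coarea`, in `Theorems/`, with the routine row PINCH∘ no longer an
input. [cite: Balaban1985Averaging, (10)-(13) p.19; Balaban1987RG1, (0.13) p.254] -/
theorem fibreMeanVersion_of_coarea
    (hC : ∀ (F : T3Family) (γ b₀ p₀ : ℝ), 0 < γ → γ ≤ 1 → 0 < b₀ → 0 < p₀ → ∃ jV : ℕ, ∀ (j : ℕ), jV ≤ j → ∃ (lam : GaugeField (F.P j) 0 ↥(Matrix.specialUnitaryGroup (Fin 2) ℂ) → MeasureTheory.Measure (GaugeField (F.P (j + 1)) 0 ↥(Matrix.specialUnitaryGroup (Fin 2) ℂ))), (∀ (V : GaugeField (F.P j) 0 ↥(Matrix.specialUnitaryGroup (Fin 2) ℂ)) (g : GaugeField (F.P (j + 1)) 0 ↥(Matrix.specialUnitaryGroup (Fin 2) ℂ)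 → ℝ), Continuous g → MeasureTheory.Integrable g (lam V)) ∧ (∀ (g : GaugeField (F.P (j + 1)) 0 ↥(Matrix.specialUnitaryGroup (Fin 2) ℂ) → ℝ), Continuous g → (∀ U, (∏ p : Plaq (F.P (j + 1)) 0, max 0 (min 1 (3 - 4 * dist1 (GaugeField.plaqHol U p) / θBal F.L γ b₀ p₀ (j + 1)))) = 0 → g U = 0) → ContinuousOn (fun V => ∫ U, g U ∂(lam V)) {V | PlaqSmall (θBal F.L γ b₀ p₀ j) V}) ∧ (∀ (V : GaugeField (F.P j) 0 ↥(Matrix.specialUnitaryGroup (Fin 2) ℂ)), PlaqSmall (θBal F.L γ b₀ p₀ j) V → 0 < lam V {U | PlaqSmall (3 / 4 * θBal F.L γ b₀ p₀ (j + 1)) U}) ∧ (∀ (σ : ProbabilityTheory.Kernel (GaugeField (F.P j) 0 ↥(Matrix.specialUnitaryGroup (Fin 2) ℂ)) (GaugeField (F.P (j + 1)) 0 ↥(Matrix.specialUnitaryGroup (Fin 2) ℂ))), ProbabilityTheory.IsMarkovKernel σ → (Measure.map (descend F ℰp j) (fieldMeasure (F.P (j + 1)) 0 ↥(Matrix.specialUnitaryGroup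 (Fin 2) ℂ))).bind ⇑σ = fieldMeasure (F.P (j + 1)) 0 ↥(Matrix.specialUnitaryGroup (Fin 2) ℂ) → (∀ᵐ V ∂(Measure.map (descend F ℰp j) (fieldMeasure (F.P (j + 1)) 0 ↥(Matrix.specialUnitaryGroup (Fin 2) ℂ))), ∀ᵐ U ∂(σ V), descend F ℰp j U = V) → ∃ (φ : GaugeField (F.P j) 0 ↥(Matrix.specialUnitaryGroup (Fin 2) ℂ) → ℝ), ∀ᵐ V ∂(fieldMeasure (F.P j) 0 ↥(Matrix.specialUnitaryGroup (Fin 2) ℂ)), PlaqSmall (θBal F.L γ b₀ p₀ j) V → 0 < φ V ∧ ∀ (g : GaugeField (F.P (j + 1)) 0 ↥(Matrix.specialUnitaryGroup (Fin 2) ℂ) → ℝ), Continuous g → (∀ U, (∏ p : Plaq (F.P (j + 1)) 0, max 0 (min 1 (3 - 4 * dist1 (GaugeField.plaqHol U p) / θBal F.L γ b₀ p₀ (j + 1)))) = 0 → g U = 0) → MeasureTheory.Integrable g (σ V) ∧ ∫ U, g U ∂(σ V) = (φ V)⁻¹ * ∫ U, g U ∂(lam V))) :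
    ∀ (F : T3Family) (γ b₀ p₀ : ℝ), 0 < γ → γ ≤ 1 → 0 < b₀ → 0 < p₀ → ∃ jV : ℕ, ∀ (j₀ : ℕ) (prm : ℕ → ClassParams) (η : ℕ → ℝ), ∀ (T : ℕ), ∀ (μ μ' : ((j : ℕ) → MeasureTheory.Measure (GaugeField (F.P j) 0 ↥(Matrix.specialUnitaryGroup (Fin 2) ℂ)))) (ρ ρ' : ((j : ℕ) → GaugeField (F.P j) 0 ↥(Matrix.specialUnitaryGroup (Fin 2) ℂ) → ℝ)), (∀ j : ℕ, j ≤ T → IsProbabilityMeasure (μ j) ∧ IsProbabilityMeasure (μ' j)) → (∀ j : ℕ, j < T → μ j = Measure.map (descend F ℰp j) (μ (j + 1)) ∧ μ' j = Measure.map (descend F ℰp j) (μ' (j + 1))) → (∀ j : ℕ, j₀ ≤ j → j ≤ T → ((∀ U, PlaqSmall (θBal F.L γ b₀ p₀ j) U → 0 < ρ j U ∧ 0 < ρ' j U) ∧ μ j = (fieldMeasure _ _ _).withDensity (fun U => ENNReal.ofReal (ρ j U)) ∧ μ' j = (fieldMeasure _ _ _).withDensity (fun U => ENNReal.ofReal (ρ'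 j U)) ∧ MemAtHeight F ℰp j (prm j) (ρ j) ∧ MemAtHeight F ℰp j (prm j) (ρ' j) ∧ μ j {U | ¬ PlaqSmall (θBal F.L γ b₀ p₀ j) U} ≤ ENNReal.ofReal (η j) ∧ μ' j {U | ¬ PlaqSmall (θBal F.L γ b₀ p₀ j) U} ≤ ENNReal.ofReal (η j) ∧ (ContinuousOn (ρ j) {U | PlaqSmall (θBal F.L γ b₀ p₀ j) U} ∧ ContinuousOn (ρ' j) {U | PlaqSmall (θBal F.L γ b₀ p₀ j) U}))) → ∀ (j : ℕ), jV ≤ j → j₀ ≤ j → j + 1 ≤ T → ∀ (σ : ProbabilityTheory.Kernel (GaugeField (F.P j) 0 ↥(Matrix.specialUnitaryGroup (Fin 2) ℂ)) (GaugeField (F.P (j + 1)) 0 ↥(Matrix.specialUnitaryGroup (Fin 2) ℂ))), ProbabilityTheory.IsMarkovKernel σ → (Measure.map (descend F ℰp j) (fieldMeasure (F.P (j + 1)) 0 ↥(Matrix.specialUnitaryGroup (Fin 2) ℂ))).bind ⇑σ = fieldMeasure (F.P (j + 1)) 0 ↥(Matrix.specialUnitaryGroup (Fin 2) ℂ) →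 (∀ᵐ V ∂(Measure.map (descend F ℰp j) (fieldMeasure (F.P (j + 1)) 0 ↥(Matrix.specialUnitaryGroup (Fin 2) ℂ))), ∀ᵐ U ∂(σ V), descend F ℰp j U = V) → ∃ (m : GaugeField (F.P j) 0 ↥(Matrix.specialUnitaryGroup (Fin 2) ℂ) → ℝ), ContinuousOn m {V | PlaqSmall (θBal F.L γ b₀ p₀ j) V} ∧ (∀ᵐ V ∂(fieldMeasure (F.P j) 0 ↥(Matrix.specialUnitaryGroup (Fin 2) ℂ)), PlaqSmall (θBal F.L γ b₀ p₀ j) V → MeasureTheory.Integrable (fun U => (∏ p : Plaq (F.P (j + 1)) 0, max 0 (min 1 (3 - 4 * dist1 (GaugeField.plaqHol U p) / θBal F.L γ b₀ p₀ (j + 1)))) * (Real.log (ρ (j + 1) U) - Real.log (ρ' (j + 1) U)) * ρ' (j + 1) U) (σ V) ∧ m V = (∫ U, (∏ p : Plaq (F.P (j + 1)) 0, max 0 (min 1 (3 - 4 * dist1 (GaugeField.plaqHol U p) / θBal F.L γ b₀ p₀ (j + 1)))) * (Real.log (ρ (j + 1) U) - Real.log (ρ' (j + 1) U)) * ρ'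 (j + 1) U ∂(σ V)) / (∫ U, (∏ p : Plaq (F.P (j + 1)) 0, max 0 (min 1 (3 - 4 * dist1 (GaugeField.plaqHol U p) / θBal F.L γ b₀ p₀ (j + 1)))) * ρ' (j + 1) U ∂(σ V))) :=
  fibreMeanVersion_of_regular (regular_of_coarea hC)

end Summit.QuantumFields.YangMills.Theorems.FluctuationComparisonRegPrIntLOrganTangentRegularVersion

end
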